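import Summits.ValiantsHypothesis.ValiantsHypothesis.Theorems.RigidityForcesSymmetryGrenetFirstOrderRankRigidGaugeAssembly
import Summits.ValiantsHypothesis.ValiantsHypothesis.Theorems.RigidityForcesSymmetryGrenetFirstOrderRankRigidWitness

/-!
# Route RigidityForcesSymmetry — `GrenetFirstOrderRankRigid` (item stmt-ValiantsHypothesis-21029),
line `grenet_gauge`: stub `stub_linearRigid`, step 6 — GLUING the block results into a gauge pair

For the crux line `Cruxes/GrenetFirstOrderRankRigid/Lines/grenet_gauge.lean` (blueprint
`Lines/grenet_gauge-stub_linearRigid-PROOF.md`, §6; interface `…-BLOCKS.md`, rev 2).  Terminology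
for an entry `(i, j, v)`, `v = (p, q)`, of a homogeneous direction `Σ_v x_v A'_v` at Grenet's pencil:
TAIL = `p ∉ R i ∧ q = |R i|` (pair `(R i + p, C j)`), HEAD = `p ∈ C j ∧ |C j| = q + 1` (pair
`(R i, C j - p)`), genuine = of one kind only.  `grenet_hom_of_blocks`: if `A'` is supported on tail
or head entries and satisfies the block conclusions

* (PQ) a genuine tail and a genuine head entry of the same pair have opposite values,
* (Tu) genuine tail entries of a pair `(univ, T)` in the same column agree,
  (H0) genuine head entries of a pair `(S, ∅)` in the same row agree,
* (Q0) genuine tail entries of a pair `(U, univ)` vanish, (P0) genuine head entries of `(∅, R')` vanish,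
* (y) a both-kind entry is `-(tail witness of its head pair) - (head witness of its tail pair)`,
* (σ) the arc entries are `φ(C j) - φ(R i)`,

then `A'` is a gauge direction: `∃ P Q, P Λ = Λ Q ∧ A'_v = P A_v - A_v Q` (the gauge function on
vertex pairs is `G(U,U) = ε φ U`, `G(U,T) = ε ·` any genuine tail witness, else `-ε ·` any genuine
head witness, else `0`, fed to `grenet_gauge_of_pairFunctions`).  No new definitions.  VP ≠ VNP is
not moved by this file.
-/

noncomputable section

open MvPolynomial Matrix Finset

namespace Summit.ValiantsHypothesis.Theorems.RigidityForcesSymmetry.GrenetGauge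

open Literature.Computability.AlgebraicComplexity

variable {k : Type*} [CommRing k] {n N : ℕ} (e : Finset (Fin n) ≃ Fin (N + 1))

set_option maxHeartbeats 800000 in
/-- **Gluing the blocks** (blueprint §6): block conclusions (PQ), (Tu), (H0), (Q0), (P0), (y), (σ)
for a direction supported on tail / head entries imply that it is a gauge direction at Grenet's
pencil `Λ = coeff_0 (Grenet.repr k n e)`, `A_v = coeff_{x_v} (Grenet.repr k n e)`. [cite: Grenet2011, Thm. 1] -/
theorem grenet_hom_of_blocks
    {Λ : Matrix (Fin N) (Fin N) k} (hΛ : ∀ i j, Λ i j = coeff 0 (Grenet.repr k n e i j))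
    {A : Fin n × Fin n → Matrix (Fin N) (Fin N) k}
    (hA : ∀ v i j, A v i j = coeff (Finsupp.single v 1) (Grenet.repr k n e i j))
    (A' : Fin n × Fin n → Matrix (Fin N) (Fin N) k)
    (hsupp : ∀ v i j, A' v i j ≠ 0 →
      (v.1 ∉ e.symm ((e univ).succAbove i) ∧ (v.2 : ℕ) = (e.symm ((e univ).succAbove i)).card) ∨
      (v.1 ∈ e.symm ((e ∅).succAbove j) ∧ (e.symm ((e ∅).succAbove j)).card = (v.2 : ℕ) + 1))
    (hPQ : ∀ (i j : Fin N) (v : Fin n × Fin n) (i' j' : Fin N) (v' : Fin n × Fin n),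
      (v.1 ∉ e.symm ((e univ).succAbove i) ∧ (v.2 : ℕ) = (e.symm ((e univ).succAbove i)).card) →
      ¬ (v.1 ∈ e.symm ((e ∅).succAbove j) ∧ (e.symm ((e ∅).succAbove j)).card = (v.2 : ℕ) + 1) →
      (v'.1 ∈ e.symm ((e ∅).succAbove j') ∧ (e.symm ((e ∅).succAbove j')).card = (v'.2 : ℕ) + 1) →
      ¬ (v'.1 ∉ e.symm ((e univ).succAbove i') ∧ (v'.2 : ℕ) = (e.symm ((e univ).succAbove i')).card) →
      insert v.1 (e.symm ((e univ).succAbove i)) = e.symm ((e univ).succAbove i') →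
      e.symm ((e ∅).succAbove j) = (e.symm ((e ∅).succAbove j')).erase v'.1 →
      A' v' i' j' = -A' v i j)
    (hTu : ∀ (i j : Fin N) (v : Fin n × Fin n) (i' : Fin N) (v' : Fin n × Fin n),
      (v.1 ∉ e.symm ((e univ).succAbove i) ∧ (v.2 : ℕ) = (e.symm ((e univ).succAbove i)).card) →
      ¬ (v.1 ∈ e.symm ((e ∅).succAbove j) ∧ (e.symm ((e ∅).succAbove j)).card = (v.2 : ℕ) + 1) →
      (v'.1 ∉ e.symm ((e univ).succAbove i') ∧ (v'.2 : ℕ) = (e.symm ((e univ).succAbove i')).card) →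
      ¬ (v'.1 ∈ e.symm ((e ∅).succAbove j) ∧ (e.symm ((e ∅).succAbove j)).card = (v'.2 : ℕ) + 1) →
      insert v.1 (e.symm ((e univ).succAbove i)) = univ → insert v'.1 (e.symm ((e univ).succAbove i')) = univ →
      A' v i j = A' v' i' j)
    (hH0 : ∀ (i j : Fin N) (v : Fin n × Fin n) (j' : Fin N) (v' : Fin n × Fin n),
      (v.1 ∈ e.symm ((e ∅).succAbove j) ∧ (e.symm ((e ∅).succAbove j)).card = (v.2 : ℕ) + 1) →
      ¬ (v.1 ∉ e.symm ((e univ).succAbove i) ∧ (v.2 : ℕ) = (e.symm ((e univ).succAbove i)).card) →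
      (v'.1 ∈ e.symm ((e ∅).succAbove j') ∧ (e.symm ((e ∅).succAbove j')).card = (v'.2 : ℕ) + 1) →
      ¬ (v'.1 ∉ e.symm ((e univ).succAbove i) ∧ (v'.2 : ℕ) = (e.symm ((e univ).succAbove i)).card) →
      (e.symm ((e ∅).succAbove j)).erase v.1 = ∅ → (e.symm ((e ∅).succAbove j')).erase v'.1 = ∅ →
      A' v i j = A' v' i j')
    (hQ0 : ∀ (i j : Fin N) (v : Fin n × Fin n),
      (v.1 ∉ e.symm ((e univ).succAbove i) ∧ (v.2 : ℕ) = (e.symm ((e univ).succAbove i)).card) →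
      ¬ (v.1 ∈ e.symm ((e ∅).succAbove j) ∧ (e.symm ((e ∅).succAbove j)).card = (v.2 : ℕ) + 1) →
      e.symm ((e ∅).succAbove j) = univ → A' v i j = 0)
    (hP0 : ∀ (i j : Fin N) (v : Fin n × Fin n),
      (v.1 ∈ e.symm ((e ∅).succAbove j) ∧ (e.symm ((e ∅).succAbove j)).card = (v.2 : ℕ) + 1) →
      ¬ (v.1 ∉ e.symm ((e univ).succAbove i) ∧ (v.2 : ℕ) = (e.symm ((e univ).succAbove i)).card) →
      e.symm ((e univ).succAbove i) = ∅ → A' v i j = 0)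
    (hy : ∀ (i j : Fin N) (v : Fin n × Fin n) (i₃ j₃ : Fin N) (v₃ : Fin n × Fin n)
        (i₄ j₄ : Fin N) (v₄ : Fin n × Fin n),
      (v.1 ∉ e.symm ((e univ).succAbove i) ∧ (v.2 : ℕ) = (e.symm ((e univ).succAbove i)).card) →
      (v.1 ∈ e.symm ((e ∅).succAbove j) ∧ (e.symm ((e ∅).succAbove j)).card = (v.2 : ℕ) + 1) →
      (v₃.1 ∉ e.symm ((e univ).succAbove i₃) ∧ (v₃.2 : ℕ) = (e.symm ((e univ).succAbove i₃)).card) →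
      ¬ (v₃.1 ∈ e.symm ((e ∅).succAbove j₃) ∧ (e.symm ((e ∅).succAbove j₃)).card = (v₃.2 : ℕ) + 1) →
      insert v₃.1 (e.symm ((e univ).succAbove i₃)) = e.symm ((e univ).succAbove i) →
      e.symm ((e ∅).succAbove j₃) = (e.symm ((e ∅).succAbove j)).erase v.1 →
      (v₄.1 ∈ e.symm ((e ∅).succAbove j₄) ∧ (e.symm ((e ∅).succAbove j₄)).card = (v₄.2 : ℕ) + 1) →
      ¬ (v₄.1 ∉ e.symm ((e univ).succAbove i₄) ∧ (v₄.2 : ℕ) = (e.symm ((e univ).succAbove i₄)).card) →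
      e.symm ((e univ).succAbove i₄) = insert v.1 (e.symm ((e univ).succAbove i)) →
      (e.symm ((e ∅).succAbove j₄)).erase v₄.1 = e.symm ((e ∅).succAbove j) →
      A' v i j = -A' v₃ i₃ j₃ - A' v₄ i₄ j₄)
    (φ : Finset (Fin n) → k)
    (hσ : ∀ (i j : Fin N) (v : Fin n × Fin n),
      (v.1 ∉ e.symm ((e univ).succAbove i) ∧ (v.2 : ℕ) = (e.symm ((e univ).succAbove i)).card) →
      e.symm ((e ∅).succAbove j) = insert v.1 (e.symm ((e univ).succAbove i)) →
      A' v i j = φ (e.symm ((e ∅).succAbove j)) - φ (e.symm ((e univ).succAbove i))) :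
    ∃ P Q : Matrix (Fin N) (Fin N) k, P * Λ = Λ * Q ∧ ∀ v, A' v = P * A v - A v * Q := by
  classical
  -- abbreviations: the predicates and the pairs of an entry `x = (i, j, v)`
  set R : Fin N → Finset (Fin n) := fun i => e.symm ((e univ).succAbove i) with hR
  set Cc : Fin N → Finset (Fin n) := fun j => e.symm ((e ∅).succAbove j) with hCc
  set TL : Fin N → Fin n × Fin n → Prop := fun i v => v.1 ∉ R i ∧ (v.2 : ℕ) = (R i).card with hTL
  set HD : Fin N → Fin n × Fin n → Prop := fun j v => v.1 ∈ Cc j ∧ (Cc j).card = (v.2 : ℕ) + 1 with hHD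
  set TW : (Fin N × Fin N × (Fin n × Fin n)) → Finset (Fin n) → Finset (Fin n) → Prop :=
    fun x U T => TL x.1 x.2.2 ∧ ¬ HD x.2.1 x.2.2 ∧ insert x.2.2.1 (R x.1) = U ∧ Cc x.2.1 = T with hTW
  set HW : (Fin N × Fin N × (Fin n × Fin n)) → Finset (Fin n) → Finset (Fin n) → Prop :=
    fun x S T => HD x.2.1 x.2.2 ∧ ¬ TL x.1 x.2.2 ∧ R x.1 = S ∧ (Cc x.2.1).erase x.2.2.1 = T with hHW
  set ε : k := (-1) ^ ((e univ : ℕ) + (e ∅ : ℕ)) with hε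
  have hε2 : ε * ε = 1 := by rw [hε, ← mul_pow, neg_one_mul, neg_neg, one_pow]
  -- the gauge function on pairs of vertices
  set Gf : Finset (Fin n) → Finset (Fin n) → k := fun U T =>
    if U = T then ε * φ U
    else if h : ∃ x, TW x U T then ε * A' h.choose.2.2 h.choose.1 h.choose.2.1
    else if h' : ∃ x, HW x U T then -(ε * A' h'.choose.2.2 h'.choose.1 h'.choose.2.1)
    else 0 with hGf
  have hRu : ∀ i, R i ≠ univ := fun i => grenet_row_ne_univ e i
  have hCe : ∀ j, Cc j ≠ ∅ := fun j => grenet_col_ne_empty e j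
  -- a genuine tail entry has distinct pair components
  have hTW_ne : ∀ x U T, TW x U T → U ≠ T := by
    rintro ⟨i, j, v⟩ U T ⟨⟨h1, h2⟩, h3, h4, h5⟩ hUT
    simp only at h1 h2 h3 h4 h5
    refine h3 ⟨?_, ?_⟩
    · rw [h5, ← hUT, ← h4]; exact Finset.mem_insert_self _ _
    · rw [h5, ← hUT, ← h4, Finset.card_insert_of_notMem h1, h2]
  have hHW_ne : ∀ x S T, HW x S T → S ≠ T := by
    rintro ⟨i, j, v⟩ S T ⟨⟨h1, h2⟩, h3, h4, h5⟩ hST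
    simp only at h1 h2 h3 h4 h5
    refine h3 ⟨?_, ?_⟩
    · rw [h4, hST, ← h5]; exact Finset.notMem_erase _ _
    · rw [h4, hST, ← h5, Finset.card_erase_of_mem h1, h2]; omega
  -- two genuine tail witnesses of the same pair agree
  have hTT : ∀ x x' U T, TW x U T → TW x' U T → A' x.2.2 x.1 x.2.1 = A' x'.2.2 x'.1 x'.2.1 := by
    rintro ⟨i, j, v⟩ ⟨i', j', v'⟩ U T ⟨ht, hnh, hU, hT⟩ ⟨ht', hnh', hU', hT'⟩
    have hjj : j = j' := Fin.succAbove_right_injective (e.symm.injective (hT.trans hT'.symm))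
    subst hjj
    by_cases hh : ∃ y, HW y U T
    · obtain ⟨⟨i₂, j₂, v₂⟩, hh2, hnt2, hS2, hR2⟩ := hh
      have e1 := hPQ i j v i₂ j₂ v₂ ht hnh hh2 hnt2 (hU.trans hS2.symm) (hT.trans hR2.symm)
      have e2 := hPQ i' j v' i₂ j₂ v₂ ht' hnh' hh2 hnt2 (hU'.trans hS2.symm) (hT'.trans hR2.symm)
      simp only at e1 e2 ⊢
      linear_combination e1 - e2
    · by_cases hTu' : T = univ
      · simp only
        rw [hQ0 i j v ht hnh (hT.trans hTu'), hQ0 i' j v' ht' hnh' (hT'.trans hTu')]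
      · have hUu : U = univ := by
          by_contra hUu
          obtain ⟨i₂, j₂, v₂, hh2, hnt2, hS2, hR2⟩ := exists_genuine_head_of_pair e (hTW_ne _ U T ⟨ht, hnh, hU, hT⟩) hUu hTu'
          exact hh ⟨(i₂, j₂, v₂), hh2, hnt2, hS2, hR2⟩
        simp only
        exact hTu i j v i' v' ht hnh ht' hnh' (hU.trans hUu) (hU'.trans hUu)
  -- the gauge function at a pair with a genuine tail witness
  have hG_tail : ∀ x U T, TW x U T → Gf U T = ε * A' x.2.2 x.1 x.2.1 := by
    intro x U T hx
    have hex : ∃ x, TW x U T := ⟨x, hx⟩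
    simp only [hGf, if_neg (hTW_ne x U T hx), dif_pos hex]
    rw [hTT _ _ U T hex.choose_spec hx]
  -- the gauge function at a pair with a genuine head witness and no tail witness
  have hG_head : ∀ x S T, HW x S T → (¬ ∃ y, TW y S T) → Gf S T = -(ε * A' x.2.2 x.1 x.2.1) := by
    rintro ⟨i, j, v⟩ S T hx hno
    have hex : ∃ x, HW x S T := ⟨(i, j, v), hx⟩
    simp only [hGf, if_neg (hHW_ne _ S T hx), dif_neg hno, dif_pos hex]
    obtain ⟨hh, hnt, hS, hT⟩ := hx
    obtain ⟨hh₀, hnt₀, hS₀, hT₀⟩ := hex.choose_spec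
    -- no tail witness: `S = ∅` or `T = ∅`
    congr 2
    have hii : hex.choose.1 = i := Fin.succAbove_right_injective (e.symm.injective (hS₀.trans hS.symm))
    by_cases hS0 : S = ∅
    · rw [hP0 _ _ _ hh₀ hnt₀ (hS₀.trans hS0), hP0 i j v hh hnt (hS.trans hS0)]
    · have hT0 : T = ∅ := by
        by_contra hT0
        obtain ⟨i₁, j₁, v₁, ht1, hnh1, hU1, hT1⟩ := exists_genuine_tail_of_pair e (hHW_ne _ S T ⟨hh, hnt, hS, hT⟩) hS0 hT0
        exact hno ⟨(i₁, j₁, v₁), ht1, hnh1, hU1, hT1⟩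
      have h := hH0 i j v hex.choose.2.1 hex.choose.2.2 hh hnt hh₀ (hii ▸ hnt₀) (hT.trans hT0) (hT₀.trans hT0)
      rw [h, ← hii]
  -- assemble
  refine grenet_gauge_of_pairFunctions e hΛ hA A' Gf Gf (fun v i j => ?_) (fun _ _ _ _ _ _ => rfl)
    (fun T hT1 hT2 => ?_) (fun S hS1 hS2 => ?_)
  · -- the gauge value of every entry
    show A' v i j = ε * (-(if HD j v then Gf (R i) ((Cc j).erase v.1) else 0) + (if TL i v then Gf (insert v.1 (R i)) (Cc j) else 0))
    by_cases ht : TL i v <;> by_cases hh : HD j v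
    · -- both kinds
      rw [if_pos hh, if_pos ht]
      by_cases harc : Cc j = insert v.1 (R i)
      · -- an arc entry
        have h1 : (Cc j).erase v.1 = R i := by rw [harc, Finset.erase_insert ht.1]
        rw [hσ i j v ht harc, h1, harc, show e.symm ((e ∅).succAbove j) = insert v.1 (R i) from harc,
          show e.symm ((e univ).succAbove i) = R i from rfl]
        simp only [hGf, if_true]
        linear_combination (φ (R i) - φ (insert v.1 (R i))) * hε2
      · -- a both-kind non-arc entry
        have hUT : insert v.1 (R i) ≠ Cc j := fun h => harc h.symm
        have hSR : R i ≠ (Cc j).erase v.1 := fun h => harc (by rw [h, Finset.insert_erase hh.1])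
        have hcard : (Cc j).card = (insert v.1 (R i)).card := by
          rw [hh.2, Finset.card_insert_of_notMem ht.1, ht.2]
        have hUu : insert v.1 (R i) ≠ univ := fun hU => hUT (by
          rw [hU]; symm; apply Finset.eq_univ_of_card; rw [hcard, hU, Finset.card_univ])
        have hTu' : Cc j ≠ univ := fun hT => hUT (by
          rw [hT]; apply Finset.eq_univ_of_card; rw [← hcard, hT, Finset.card_univ])
        have hS0 : R i ≠ ∅ := fun h => by
          -- `R i = ∅` forces `|C j| = 1`, `C j = {v.1}`, so the entry would be an arc entry
          apply harc
          have hc1 : (Cc j).card = 1 := by rw [hh.2, ht.2, h, Finset.card_empty]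
          obtain ⟨a, ha⟩ := Finset.card_eq_one.mp hc1
          have hva : v.1 = a := Finset.mem_singleton.mp (by rw [← ha]; exact hh.1)
          rw [h, Finset.insert_empty, ha, hva]
        have hR0 : (Cc j).erase v.1 ≠ ∅ := fun h => hS0 (by
          have h1 : (R i).card = 0 := by
            have := Finset.card_erase_of_mem hh.1
            rw [h, Finset.card_empty, hh.2] at this; omega
          exact Finset.card_eq_zero.mp h1)
        obtain ⟨i₃, j₃, v₃, ht3, hnh3, hU3, hT3⟩ := exists_genuine_tail_of_pair e hSR hS0 hR0
        obtain ⟨i₁, j₁, v₁, ht1, hnh1, hU1, hT1⟩ := exists_genuine_tail_of_pair e hUT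
          (Finset.insert_ne_empty _ _) (hCe j)
        obtain ⟨i₄, j₄, v₄, hh4, hnt4, hS4, hR4⟩ := exists_genuine_head_of_pair e hUT hUu hTu'
        rw [hG_tail (i₁, j₁, v₁) _ _ ⟨ht1, hnh1, hU1, hT1⟩, hG_tail (i₃, j₃, v₃) _ _ ⟨ht3, hnh3, hU3, hT3⟩,
          hy i j v i₃ j₃ v₃ i₄ j₄ v₄ ht hh ht3 hnh3 hU3 hT3 hh4 hnt4 hS4 hR4,
          hPQ i₁ j₁ v₁ i₄ j₄ v₄ ht1 hnh1 hh4 hnt4 (hU1.trans hS4.symm) (hT1.trans hR4.symm)]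
        simp only
        linear_combination (A' v₃ i₃ j₃ - A' v₁ i₁ j₁) * hε2
    · -- a genuine tail entry
      rw [if_neg hh, if_pos ht, hG_tail (i, j, v) _ _ ⟨ht, hh, rfl, rfl⟩]
      simp only
      linear_combination (-(A' v i j)) * hε2
    · -- a genuine head entry
      rw [if_pos hh, if_neg ht]
      by_cases htw : ∃ y, TW y (R i) ((Cc j).erase v.1)
      · obtain ⟨⟨i₁, j₁, v₁⟩, ht1, hnh1, hU1, hT1⟩ := htw
        rw [hG_tail (i₁, j₁, v₁) _ _ ⟨ht1, hnh1, hU1, hT1⟩, hPQ i₁ j₁ v₁ i j v ht1 hnh1 hh ht hU1 hT1]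
        simp only
        linear_combination (A' v₁ i₁ j₁) * hε2
      · rw [hG_head (i, j, v) _ _ ⟨hh, ht, rfl, rfl⟩ htw]
        simp only
        linear_combination (-(A' v i j)) * hε2
    · -- neither: the entry vanishes
      rw [if_neg hh, if_neg ht]
      have h0 : A' v i j = 0 := by
        by_contra h0
        rcases hsupp v i j h0 with h' | h'
        · exact ht h'
        · exact hh h'
      rw [h0]; ring
  · -- `Gf ∅ T = 0` for a middle vertex `T`
    show Gf ∅ T = 0
    have hne : (∅ : Finset (Fin n)) ≠ T := fun h => hT1 h.symm
    have hno : ¬ ∃ x, TW x ∅ T := by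
      rintro ⟨x, -, -, hU, -⟩
      exact Finset.insert_ne_empty _ _ hU
    by_cases hhw : ∃ x, HW x ∅ T
    · obtain ⟨⟨i, j, v⟩, hx⟩ := hhw
      rw [hG_head (i, j, v) _ _ hx hno]
      simp only
      rw [hP0 i j v hx.1 hx.2.1 hx.2.2.1, mul_zero, neg_zero]
    · simp only [hGf, if_neg hne, dif_neg hno, dif_neg hhw]
  · -- `Gf S univ = 0` for a middle vertex `S`
    show Gf S univ = 0
    by_cases htw : ∃ x, TW x S univ
    · obtain ⟨⟨i, j, v⟩, hx⟩ := htw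
      rw [hG_tail (i, j, v) _ _ hx]
      simp only
      rw [hQ0 i j v hx.1 hx.2.1 hx.2.2.2, mul_zero]
    · have hno : ¬ ∃ x, HW x S univ := by
        rintro ⟨⟨i, j, v⟩, hh, -, -, hT⟩
        have : v.1 ∈ (Cc j).erase v.1 := by rw [hT]; exact Finset.mem_univ _
        exact Finset.notMem_erase _ _ this
      simp only [hGf, if_neg hS2, dif_neg htw, dif_neg hno]

end Summit.ValiantsHypothesis.Theorems.RigidityForcesSymmetry.GrenetGauge
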